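import Summits.QuantumFields.YangMills.Theorems.FemtoTransferGapPhysL2
import Literature.Analysis.OperatorTheory.CompactCompression
import HarnessLib

/-!
# The WALLED physical subspace of `L²(configMeasure)` and the hard-wall (Dirichlet) compression of the transfer operator
# (brick 1 of the walled spectral package — route `FemtoCutoffLadder`, crux `LocalWallStep` stmt-QuantumFields-26282, CANCELLATION route)

Seat `leafhand-qf-femtocutoffladder-2` g0 (2026-08-30), `--supports stmt-QuantumFields-26282`.  The cruxes of LINE g5-A / LINE 2
(`LocalWallStep` 26282, `SingleWallStep` 26631, `LastWallStep` 26638, `LargeFieldInsensitivityR` 26197, `SmallFieldOctaveStep` 25695) speak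
about WALLED variational values `t = sSup (rayleighSet W)`, `s = inf_φ sSup (rayleighSet (W ∧ ⊥φ))` for a support constraint
`W ψ := ∀ U ∉ S, ψ U = 0` (hard wall off a «good» set `S`).  The cancellation route for 26282 (this seat's verdict, crux note
`Cruxes/LocalWallStep/REDUCTION-onePlaquetteRarity.md` v2) needs walled EIGENFUNCTIONS; the tree's spectral layer
(`FemtoTransferGapPhysL2 → …Spectral → …Eigenbasis → …GroundState`) is written for the `K_β`-INVARIANT physical subspace `physL2 L`, while a
walled subspace is not `K_β`-invariant.  This file supplies the first brick of the walled version: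

* §1 `walledSub S` — the physical zero-flux test functions vanishing off `S` (a submodule of `physSubmodule L`); `walledCore S`, `walledL2 S`
  — its image in `L²` and the closure (a closed subspace of `physL2 L`), with closure induction;
* §2 ★ `exists_walledOp` — for the `L²` transfer operator `A` (any representative as in `PhysL2.exists_transferOpL2`) and ANY set `S`: the
  Dirichlet compression `T_S = P ∘ A ∘ ι` on `walledL2 S` is a bounded SELF-ADJOINT, COMPACT operator with `⟪v, T_S w⟫ = ⟪v, A w⟫` on
  `walledL2 S` (Lit ✓`exists_compression_general`, p795806), POSITIVE for `β ≥ 0` (`inner_apply_nonneg` on `physL2 ⊇ walledL2`), and on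
  walled test functions `⟪ψ, T_S φ⟫ = qform su2Rep β ψ φ`.
Next bricks (not here): `¬ FiniteDimensional (walledL2 S)` for open good sets; identification of the first two eigenvalues of `T_S` with the
tree's walled `t`, `s` (dense-core GLB, as in `FemtoTransferGapSpectral` §7–§8); honest walled eigenfunction representatives
`φ = λ⁻¹ 1_S K_β e` and the Doob identity (`energy_mul_eq`) for them.
HONEST FRAMING: fixed-lattice functional analysis; no estimate; R2b1 RECORD rung — not infinite volume, not a mass gap, not Clay; no summit is
proved by this file.  Definitions: `walledSub`, `walledCore`, `walledL2` (route-posited objects of the walled spectral package).  No named facts,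
no `sorry`.  [cite: ReedSimonIV1978, Thm. XIII.1] [cite: ReedSimonI1980, Thm. VI.16]
-/

set_option autoImplicit false

noncomputable section

open MeasureTheory Filter Topology Real
open Literature.MathematicalPhysics.QuantumFieldTheory
open Literature.MathematicalPhysics.QuantumLattice
open Literature.Analysis.OperatorTheory
open scoped InnerProductSpace

namespace Summit.QuantumFields.YangMills.Theorems.FemtoTransferGap.PhysL2

open Summit.QuantumFields.YangMills.Theorems.FemtoTransferGap

variable {L : ℕ} [NeZero L]

/-! ## §1 The walled physical subspace and its `L²` closure -/

variable (L) in
/-- **Walled physical test functions**: physical zero-flux test functions vanishing off the «good» set `S` (hard wall on `Sᶜ`).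
[cite: ReedSimonIV1978, Thm. XIII.1] -/
def walledSub (S : Set (GaugeConfig 3 L SU2)) : Submodule ℝ (physSubmodule L) where
  carrier := {ψ | ∀ U, U ∉ S → (ψ : GaugeConfig 3 L SU2 → ℝ) U = 0}
  zero_mem' := fun _ _ => rfl
  add_mem' := fun {ψ φ} hψ hφ U hU => by
    change (ψ : GaugeConfig 3 L SU2 → ℝ) U + (φ : GaugeConfig 3 L SU2 → ℝ) U = 0
    rw [hψ U hU, hφ U hU, add_zero]
  smul_mem' := fun c ψ hψ U hU => by
    change c * (ψ : GaugeConfig 3 L SU2 → ℝ) U = 0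
    rw [hψ U hU, mul_zero]

omit [NeZero L] in
/-- Membership in `walledSub`. [folklore] -/
theorem mem_walledSub_iff {S : Set (GaugeConfig 3 L SU2)} {ψ : physSubmodule L} :
    ψ ∈ walledSub L S ↔ ∀ U, U ∉ S → (ψ : GaugeConfig 3 L SU2 → ℝ) U = 0 := Iff.rfl

variable (L) in
/-- **The walled core**: the `L²` classes of walled physical test functions. [cite: ReedSimonIV1978, Thm. XIII.2] -/
def walledCore (S : Set (GaugeConfig 3 L SU2)) : Submodule ℝ (Lp ℝ 2 (configMeasure SU2 L)) :=
  (walledSub L S).map (toL2 (L := L))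

variable (L) in
/-- **The walled closed subspace of `L²(configMeasure)`**: the closure of the walled core. [cite: ReedSimonIV1978, Thm. XIII.2] -/
def walledL2 (S : Set (GaugeConfig 3 L SU2)) : Submodule ℝ (Lp ℝ 2 (configMeasure SU2 L)) := (walledCore L S).topologicalClosure

/-- `toL2 ψ` of a walled test function lies in the walled core. [folklore] -/
theorem toL2_mem_walledCore {S : Set (GaugeConfig 3 L SU2)} {ψ : physSubmodule L} (hψ : ψ ∈ walledSub L S) :
    toL2 ψ ∈ walledCore L S :=
  Submodule.mem_map_of_mem hψ

/-- Core elements are classes of walled test functions. [folklore] -/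
theorem mem_walledCore_iff {S : Set (GaugeConfig 3 L SU2)} {v : Lp ℝ 2 (configMeasure SU2 L)} :
    v ∈ walledCore L S ↔ ∃ ψ : physSubmodule L, ψ ∈ walledSub L S ∧ toL2 ψ = v := by
  constructor
  · intro hv
    obtain ⟨ψ, hψ, rfl⟩ := Submodule.mem_map.mp hv
    exact ⟨ψ, hψ, rfl⟩
  · rintro ⟨ψ, hψ, rfl⟩
    exact toL2_mem_walledCore hψ

/-- The walled core lies in the physical core, hence the walled closed subspace in the physical closed subspace. [folklore] -/
theorem walledL2_le_physL2 (S : Set (GaugeConfig 3 L SU2)) : walledL2 L S ≤ physL2 L := by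
  refine Submodule.topologicalClosure_mono ?_
  intro v hv
  obtain ⟨ψ, -, rfl⟩ := mem_walledCore_iff.mp hv
  exact toL2_mem_physCore ψ

/-- The walled core lies in the walled closed subspace. [folklore] -/
theorem walledCore_le_walledL2 (S : Set (GaugeConfig 3 L SU2)) : walledCore L S ≤ walledL2 L S :=
  Submodule.le_topologicalClosure _

/-- The walled closed subspace is closed (hence complete). [folklore] -/
theorem isClosed_walledL2 (S : Set (GaugeConfig 3 L SU2)) : IsClosed (walledL2 L S : Set (Lp ℝ 2 (configMeasure SU2 L))) :=
  Submodule.isClosed_topologicalClosure _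

/-- The walled closed subspace is complete (a closed subspace of `L²`). [folklore] -/
instance instCompleteSpaceWalledL2 (S : Set (GaugeConfig 3 L SU2)) : CompleteSpace (walledL2 L S) :=
  (isClosed_walledL2 S).completeSpace_coe

/-- **Closure induction** for the walled subspace. [folklore] -/
theorem walledL2_induction {S : Set (GaugeConfig 3 L SU2)} {P : Set (Lp ℝ 2 (configMeasure SU2 L))} (hP : IsClosed P)
    (hcore : ∀ ψ : physSubmodule L, ψ ∈ walledSub L S → toL2 ψ ∈ P) {v : Lp ℝ 2 (configMeasure SU2 L)}
    (hv : v ∈ walledL2 L S) : v ∈ P := by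
  have hsub : (walledCore L S : Set (Lp ℝ 2 (configMeasure SU2 L))) ⊆ P := by
    intro w hw
    obtain ⟨ψ, hψ, rfl⟩ := mem_walledCore_iff.mp hw
    exact hcore ψ hψ
  have hv' : v ∈ closure (walledCore L S : Set (Lp ℝ 2 (configMeasure SU2 L))) := by
    have := Submodule.topologicalClosure_coe (walledCore L S)
    rw [walledL2] at hv
    rw [← this]; exact hv
  exact closure_minimal hsub hP hv'

/-! ## §2 ★ The hard-wall (Dirichlet) compression of the transfer operator -/

/-- ★ **The walled transfer operator.**  For the `L²` transfer operator `A` of `K_β` (as produced by `exists_transferOpL2`) and ANY set `S`: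
there is a bounded operator `T` on `walledL2 L S` with the form of `A` (`⟪v, T w⟫ = ⟪v, A w⟫`), self-adjoint and compact; for `β ≥ 0` it is
positive; and on walled test functions `⟪toL2 ψ, T (toL2 φ)⟫ = qform su2Rep β ψ φ`.  (The walled subspace is NOT `A`-invariant: this is the
compression `P ∘ A ∘ ι`, Lit `exists_compression_general`.) [cite: ReedSimonI1980, Thm. VI.16] [cite: ReedSimonIV1978, Thm. XIII.1] -/
theorem exists_walledOp {β : ℝ} {A : Lp ℝ 2 (configMeasure SU2 L) →L[ℝ] Lp ℝ 2 (configMeasure SU2 L)}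
    (hA : ∀ v : Lp ℝ 2 (configMeasure SU2 L),
      (A v : GaugeConfig 3 L SU2 → ℝ) =ᵐ[configMeasure SU2 L] fun U => ∫ V, transferKernel su2Rep β U V * v V ∂configMeasure SU2 L)
    (hAsa : IsSelfAdjoint A) (hAc : IsCompactOperator A) (S : Set (GaugeConfig 3 L SU2)) :
    ∃ T : walledL2 L S →L[ℝ] walledL2 L S,
      (∀ v w : walledL2 L S, ⟪v, T w⟫_ℝ = ⟪(v : Lp ℝ 2 (configMeasure SU2 L)), A w⟫_ℝ) ∧
      IsSelfAdjoint T ∧ IsCompactOperator T ∧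
      (0 ≤ β → ∀ v : walledL2 L S, 0 ≤ ⟪v, T v⟫_ℝ) ∧
      (∀ (ψ φ : physSubmodule L) (hψ : ψ ∈ walledSub L S) (hφ : φ ∈ walledSub L S),
        ⟪(⟨toL2 ψ, walledCore_le_walledL2 S (toL2_mem_walledCore hψ)⟩ : walledL2 L S),
          T ⟨toL2 φ, walledCore_le_walledL2 S (toL2_mem_walledCore hφ)⟩⟫_ℝ =
          qform su2Rep β (ψ : GaugeConfig 3 L SU2 → ℝ) φ) := by
  obtain ⟨T, hin, hsa, hc, -⟩ := exists_compression_general A (walledL2 L S)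
  refine ⟨T, hin, hsa hAsa, hc hAc, fun hβ v => ?_, fun ψ φ hψ hφ => ?_⟩
  · rw [hin]
    exact inner_apply_nonneg hA hβ (walledL2_le_physL2 S v.2)
  · rw [hin]
    exact inner_apply_toL2 hA ψ φ

end Summit.QuantumFields.YangMills.Theorems.FemtoTransferGap.PhysL2

end
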